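import Summits.HubbardSuperconductivity.HubbardSuperconductivity.Theorems.KacWindowPenaltyWindowGapTwistedPairField
import Literature.MathematicalPhysics.QuantumLattice.PairFieldMomentum
import Literature.MathematicalPhysics.QuantumLattice.PatchPairOperator

/-!
# Crux `WindowInfraredBound` (item `stmt-HubbardSuperconductivity-1089`), negative side:
# the twisted `d`-wave pair field as a weighted pair annihilator, and the momentum boxes

Bookkeeping for the witness of `…/Negative/AllSectorStates.lean` (the ground-state hypothesis of the crux
is load-bearing).

* `conjTranspose_twist_mul_pairFieldAt_dWave_mul` — conjugating the `d`-wave pair field at the momentum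
  `−2jê₁` by the Lieb–Schultz–Mattis twist `G_j = phaseGauge (twistGauge L (2πj))` gives a weighted
  ZERO-momentum pair annihilator: `G_jᴴ Δ_d(−2jê₁) G_j = Σ_k W_k b_k`, `b_k = pairMode k = c_{−k↓}c_{k↑}`,
  `W_k = −Σ_e conj χ_{jê₁}(e) · pairFieldMode (d·1_e) L k` (bond-by-bond covariance
  `conjTranspose_twist_mul_pairFieldAt_single_mul` of `KacWindowPenaltyWindowGapTwistedPairField`, then
  `Δ_g(0) = Δ_g = −Σ_k w_g(k) b_k` of `PatchPairOperator`);
* `re_twistWeight` — its profile `Re W_k = 2√2 (cos p₂(k) − ρ cos p₁(k))`, `ρ = Re conj χ_{jê₁}(ê₁)` (the two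
  horizontal bonds carry conjugate phases, the vertical ones none); the VALUE of `ρ` is never needed below;
* the momentum boxes `{(o + i, j) : i ≤ 3t, j ≤ 2t} ⊆ (ℤ/Lℤ)²` on the torus of side `L = 12t` (literal
  `Finset.image` terms): `le_card_box` (`≥ 6t²` points), `cos_box` (`cos p₂ ≥ 1/2`; `cos p₁ ≥ 0` at offset
  `o = 0`, `cos p₁ ≤ 0` at offset `o = 3t`) — elementary cosine facts on `[0, π/3]`, `[0, π/2]`, `[π/2, π]`.

No definition is introduced.  Sources: H. Watanabe, J. Stat. Phys. 177 (2019) 717, §2.2.1 (twist);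
D. J. Scalapino, Phys. Rep. 250 (1995) 329, §2 (`d`-wave form factor).
-/

-- the mandated namespace `Summit.<Summit>.<Problem>.Theorems` repeats `HubbardSuperconductivity`
-- (single-problem summit, D-0017), which the `dupNamespace` linter flags on every declaration
set_option linter.dupNamespace false

noncomputable section

namespace Summit.HubbardSuperconductivity.HubbardSuperconductivity.Theorems.WindowInfraredBound.Negative

open Literature.MathematicalPhysics.QuantumLattice Literature.Probability.LatticeModels Matrix Finset
open scoped ComplexOrder ComplexConjugate

section Weight

variable {L : ℕ} [NeZero L]

/-! ### The twisted `d`-wave pair field is a weighted zero-momentum pair annihilator -/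

omit [NeZero L] in
/-- A sum over `{0} ∪ unitSteps`, expanded over the five steps `0, e₁, -e₁, e₂, -e₂`. [folklore] -/
theorem sum_insert_zero_unitSteps_expand {M : Type*} [AddCommMonoid M] (f : Site 2 → M) :
    ∑ e ∈ insert 0 unitSteps, f e =
      f 0 + (f (Pi.single 0 1) + (f (-Pi.single 0 1) + (f (Pi.single 1 1) + f (-Pi.single 1 1)))) := by
  have h0 : (0 : Site 2) ∉ unitSteps := by
    simp only [unitSteps, Finset.mem_insert, Finset.mem_singleton]; decide
  have h1 : (Pi.single 0 1 : Site 2) ∉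
      ({-Pi.single 0 1, Pi.single 1 1, -Pi.single 1 1} : Finset (Site 2)) := by
    simp only [Finset.mem_insert, Finset.mem_singleton]; decide
  have h2 : (-Pi.single 0 1 : Site 2) ∉ ({Pi.single 1 1, -Pi.single 1 1} : Finset (Site 2)) := by
    simp only [Finset.mem_insert, Finset.mem_singleton]; decide
  have h3 : (Pi.single 1 1 : Site 2) ∉ ({-Pi.single 1 1} : Finset (Site 2)) := by
    simp only [Finset.mem_singleton]; decide
  rw [Finset.sum_insert h0, unitSteps, Finset.sum_insert h1, Finset.sum_insert h2,
    Finset.sum_insert h3, Finset.sum_singleton]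

/-- **Single-bond profile**: `pairFieldMode (f·1_e) L k = √2 · f_e · Re χ_k(e)` for a step
`e ∈ {0} ∪ unitSteps`. [folklore] -/
theorem pairFieldMode_single {e : Site 2} (he : e ∈ insert (0 : Site 2) unitSteps) (c : ℝ)
    (k : TorusSite 2 L) :
    pairFieldMode (Pi.single e c) L k = Real.sqrt 2 * (c * (torusChar k (Torus.proj L e)).re) := by
  rw [pairFieldMode, Finset.sum_eq_single e]
  · rw [Pi.single_eq_same]
  · intro e' _ hne
    rw [Pi.single_eq_of_ne hne, zero_mul]
  · intro h
    exact absurd he h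

/-- **The twisted `d`-wave pair field at the window momentum `−2jê₁` is a weighted zero-momentum pair
annihilator**: `G_jᴴ Δ_d(−2jê₁) G_j = Σ_k W_k b_k` with
`W_k = −Σ_{e} conj χ_{jê₁}(e) · pairFieldMode (d·1_e) L k` (bond-by-bond covariance
`conjTranspose_twist_mul_pairFieldAt_single_mul`, `Δ_g(0) = Δ_g = −Σ_k w_g(k) b_k`).
Watanabe, J. Stat. Phys. 177 (2019) 717, §2.2.1; Scalapino, Phys. Rep. 250 (1995) 329, §2. [folklore] -/
theorem conjTranspose_twist_mul_pairFieldAt_dWave_mul (j : ℤ) :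
    (phaseGauge fun u : FermionTorus 2 L => twistGauge L (j * (2 * Real.pi)) u.toTorusSite)ᴴ *
        pairFieldAt dWaveFormFactor L (-(Pi.single 0 (((2 * j : ℤ)) : ZMod L))) *
        phaseGauge (fun u : FermionTorus 2 L => twistGauge L (j * (2 * Real.pi)) u.toTorusSite) =
      ∑ k : TorusSite 2 L,
        (-(∑ e ∈ insert (0 : Site 2) unitSteps,
            conj (torusChar (Pi.single 0 ((j : ℤ) : ZMod L) : TorusSite 2 L) (Torus.proj L e)) *
              (pairFieldMode (Pi.single e (dWaveFormFactor e)) L k : ℂ))) • pairMode k := by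
  rw [pairFieldAt_eq_sum_single dWaveFormFactor, Finset.mul_sum, Finset.sum_mul]
  have h1 : ∀ e ∈ insert (0 : Site 2) unitSteps,
      (phaseGauge fun u : FermionTorus 2 L => twistGauge L (j * (2 * Real.pi)) u.toTorusSite)ᴴ *
          pairFieldAt (Pi.single e (dWaveFormFactor e)) L (-(Pi.single 0 (((2 * j : ℤ)) : ZMod L))) *
          phaseGauge (fun u : FermionTorus 2 L => twistGauge L (j * (2 * Real.pi)) u.toTorusSite) =
        ∑ k : TorusSite 2 L,
          (-(conj (torusChar (Pi.single 0 ((j : ℤ) : ZMod L) : TorusSite 2 L) (Torus.proj L e)) *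
              (pairFieldMode (Pi.single e (dWaveFormFactor e)) L k : ℂ))) • pairMode k := by
    intro e he
    rw [conjTranspose_twist_mul_pairFieldAt_single_mul dWaveFormFactor he j, neg_add_cancel,
      pairFieldAt_zero, pairField_eq_neg_sum_pairFieldMode_smul_pairMode, smul_neg, Finset.smul_sum,
      ← Finset.sum_neg_distrib]
    refine Finset.sum_congr rfl fun k _ => ?_
    rw [smul_smul, neg_smul]
  rw [Finset.sum_congr rfl h1, Finset.sum_comm]
  refine Finset.sum_congr rfl fun k _ => ?_
  rw [← Finset.sum_smul, Finset.sum_neg_distrib]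

/-- `χ_{aê₁}(±e₂) = 1`: a character with momentum along `ê₁` does not see vertical steps. [folklore] -/
theorem torusChar_single_zero_proj_snd (a : ZMod L) (s : ℤˣ) :
    torusChar (Pi.single 0 a : TorusSite 2 L) (Torus.proj L ((s : ℤ) • Pi.single 1 1)) = 1 := by
  unfold torusChar
  rw [Fin.prod_univ_two, Pi.single_eq_same, Pi.single_eq_of_ne (by decide : (1 : Fin 2) ≠ 0), zero_mul,
    AddChar.map_zero_eq_one, mul_one]
  have : (Torus.proj L ((s : ℤ) • (Pi.single 1 1 : Site 2))) 0 = 0 := by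
    simp [Torus.proj]
  rw [this, mul_zero, AddChar.map_zero_eq_one]

/-- **Profile of the twisted weight**: `Re W_k = 2√2 (cos p₂(k) − ρ cos p₁(k))` with
`ρ = Re conj χ_{jê₁}(ê₁)` (the two horizontal bonds carry the conjugate phases `u, ū`, the vertical ones
none; `d(±ê₁) = 1`, `d(±ê₂) = −1`, `d(0) = 0`). [folklore] -/
theorem re_twistWeight (j : ℤ) (k : TorusSite 2 L) :
    (-(∑ e ∈ insert (0 : Site 2) unitSteps,
        conj (torusChar (Pi.single 0 ((j : ℤ) : ZMod L) : TorusSite 2 L) (Torus.proj L e)) *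
          (pairFieldMode (Pi.single e (dWaveFormFactor e)) L k : ℂ))).re =
      2 * Real.sqrt 2 * (Real.cos (latticeMomentum L k 1) -
        (conj (torusChar (Pi.single 0 ((j : ℤ) : ZMod L) : TorusSite 2 L)
            (Torus.proj L (Pi.single 0 1)))).re * Real.cos (latticeMomentum L k 0)) := by
  -- the five form-factor values
  have hg0 : dWaveFormFactor 0 = 0 := dWaveFormFactor_zero
  have hg1 : dWaveFormFactor (Pi.single 0 1) = 1 := if_pos (Or.inl rfl)
  have hg2 : dWaveFormFactor (-Pi.single 0 1) = 1 := if_pos (Or.inr rfl)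
  have hne1 : (Pi.single 1 1 : Site 2) ≠ Pi.single 0 1 := fun h => by simpa using congrFun h 0
  have hne2 : (Pi.single 1 1 : Site 2) ≠ -Pi.single 0 1 := fun h => by simpa using congrFun h 0
  have hne3 : (-Pi.single 1 1 : Site 2) ≠ Pi.single 0 1 := fun h => by simpa using congrFun h 0
  have hne4 : (-Pi.single 1 1 : Site 2) ≠ -Pi.single 0 1 := fun h => by simpa using congrFun h 1
  have hg3 : dWaveFormFactor (Pi.single 1 1) = -1 := by
    rw [dWaveFormFactor, if_neg (not_or.2 ⟨hne1, hne2⟩), if_pos (Or.inl rfl)]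
  have hg4 : dWaveFormFactor (-Pi.single 1 1) = -1 := by
    rw [dWaveFormFactor, if_neg (not_or.2 ⟨hne3, hne4⟩), if_pos (Or.inr rfl)]
  -- the four cosines
  have hx : ∀ s : ℤˣ, (torusChar k (Torus.proj L ((s : ℤ) • Pi.single 0 1))).re =
      Real.cos (latticeMomentum L k 0) := fun s => re_torusChar_proj_single k 0 s
  have hy : ∀ s : ℤˣ, (torusChar k (Torus.proj L ((s : ℤ) • Pi.single 1 1))).re =
      Real.cos (latticeMomentum L k 1) := fun s => re_torusChar_proj_single k 1 s
  have hx1 := hx 1; have hx2 := hx (-1); have hy1 := hy 1; have hy2 := hy (-1)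
  simp only [Units.val_one, one_smul, Units.val_neg, neg_smul] at hx1 hx2 hy1 hy2
  -- the bond phases: `u(-e₁) = conj u(e₁)`, `u(±e₂) = 1`
  set z : ℂ := torusChar (Pi.single 0 ((j : ℤ) : ZMod L) : TorusSite 2 L) (Torus.proj L (Pi.single 0 1))
    with hz
  have hneg : Torus.proj L (-(Pi.single 0 1 : Site 2)) = -Torus.proj L (Pi.single 0 1) := by
    funext i
    simp [Torus.proj]
  have hu2 : torusChar (Pi.single 0 ((j : ℤ) : ZMod L) : TorusSite 2 L) (Torus.proj L (-(Pi.single 0 1))) =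
      conj z := by
    rw [hneg, torusChar_neg_right]
  have hv1 := torusChar_single_zero_proj_snd (L := L) ((j : ℤ) : ZMod L) 1
  have hv2 := torusChar_single_zero_proj_snd (L := L) ((j : ℤ) : ZMod L) (-1)
  simp only [Units.val_one, one_smul, Units.val_neg, neg_smul] at hv1 hv2
  have hmem0 : (0 : Site 2) ∈ insert (0 : Site 2) unitSteps := Finset.mem_insert_self _ _
  have hmem : ∀ e ∈ unitSteps, e ∈ insert (0 : Site 2) unitSteps := fun e he => Finset.mem_insert_of_mem he
  have hm1 : (Pi.single 0 1 : Site 2) ∈ unitSteps := by simp [unitSteps]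
  have hm2 : (-Pi.single 0 1 : Site 2) ∈ unitSteps := by simp [unitSteps]
  have hm3 : (Pi.single 1 1 : Site 2) ∈ unitSteps := by simp [unitSteps]
  have hm4 : (-Pi.single 1 1 : Site 2) ∈ unitSteps := by simp [unitSteps]
  rw [sum_insert_zero_unitSteps_expand, pairFieldMode_single hmem0, pairFieldMode_single (hmem _ hm1),
    pairFieldMode_single (hmem _ hm2), pairFieldMode_single (hmem _ hm3), pairFieldMode_single (hmem _ hm4),
    hg0, hg1, hg2, hg3, hg4, hx1, hx2, hy1, hy2, hu2, hv1, hv2, ← hz]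
  simp only [Complex.neg_re, Complex.add_re, Complex.re_mul_ofReal, map_one, Complex.one_re,
    Complex.conj_conj, Complex.conj_re]
  ring

end Weight

section Box

variable {L : ℕ}

/-! ### The momentum boxes -/

/-- `(o + i) mod L` has representative `o + i` when `o + i < L`. [folklore] -/
theorem val_natCast_of_lt {a : ℕ} (ha : a < L) : ((a : ℕ) : ZMod L).val = a := by
  rw [ZMod.val_natCast, Nat.mod_eq_of_lt ha]

/-- The box map `(i, j) ↦ (o + i, j)` into `(ℤ/Lℤ)²` is injective on `[0, 3t] × [0, 2t]` when
`o + 3t < L` and `2t < L`. [folklore] -/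
theorem box_injOn (o t : ℕ) (ho : o + 3 * t < L) (ht : 2 * t < L) :
    Set.InjOn (fun p : ℕ × ℕ => (![((o + p.1 : ℕ) : ZMod L), ((p.2 : ℕ) : ZMod L)] : TorusSite 2 L))
      ((Finset.range (3 * t + 1) ×ˢ Finset.range (2 * t + 1) : Finset (ℕ × ℕ)) : Set (ℕ × ℕ)) := by
  intro p hp q hq hpq
  simp only [Finset.coe_product, Set.mem_prod, Finset.coe_range, Set.mem_Iio] at hp hq
  have h0 := congrFun hpq 0
  have h1 := congrFun hpq 1
  simp only [Matrix.cons_val_zero, Matrix.cons_val_one] at h0 h1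
  have h0' := congrArg ZMod.val h0
  have h1' := congrArg ZMod.val h1
  rw [val_natCast_of_lt (by omega), val_natCast_of_lt (by omega)] at h0' h1'
  exact Prod.ext (by omega) h1'

/-- **The box has `(3t+1)(2t+1) ≥ 6t²` momenta.** [folklore] -/
theorem le_card_box (o t : ℕ) (ho : o + 3 * t < L) (ht : 2 * t < L) :
    6 * t ^ 2 ≤ ((Finset.range (3 * t + 1) ×ˢ Finset.range (2 * t + 1)).image
      (fun p : ℕ × ℕ => (![((o + p.1 : ℕ) : ZMod L), ((p.2 : ℕ) : ZMod L)] : TorusSite 2 L))).card := by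
  rw [Finset.card_image_of_injOn (box_injOn o t ho ht), Finset.card_product, Finset.card_range,
    Finset.card_range]
  nlinarith

/-- Coordinates of a box momentum: `(k 0).val = o + i`, `(k 1).val = j`. [folklore] -/
theorem mem_box_iff {o t : ℕ} (ho : o + 3 * t < L) (ht : 2 * t < L) {k : TorusSite 2 L} :
    k ∈ ((Finset.range (3 * t + 1) ×ˢ Finset.range (2 * t + 1)).image
      (fun p : ℕ × ℕ => (![((o + p.1 : ℕ) : ZMod L), ((p.2 : ℕ) : ZMod L)] : TorusSite 2 L))) →
      ∃ i j : ℕ, i ≤ 3 * t ∧ j ≤ 2 * t ∧ (k 0).val = o + i ∧ (k 1).val = j := by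
  intro hk
  rw [Finset.mem_image] at hk
  obtain ⟨p, hp, rfl⟩ := hk
  rw [Finset.mem_product, Finset.mem_range, Finset.mem_range] at hp
  refine ⟨p.1, p.2, by omega, by omega, ?_, ?_⟩
  · have h0 : (![((o + p.1 : ℕ) : ZMod L), ((p.2 : ℕ) : ZMod L)] : TorusSite 2 L) 0 =
        ((o + p.1 : ℕ) : ZMod L) := rfl
    rw [h0, val_natCast_of_lt (by omega)]
  · have h1 : (![((o + p.1 : ℕ) : ZMod L), ((p.2 : ℕ) : ZMod L)] : TorusSite 2 L) 1 =
        ((p.2 : ℕ) : ZMod L) := rfl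
    rw [h1, val_natCast_of_lt (by omega)]

/-- **Cosines on the boxes** (`L = 12t`): the second coordinate `j ≤ 2t` has `cos p₂ ≥ 1/2`
(`p₂ = 2πj/L ≤ π/3`); the first has `cos p₁ ≥ 0` on the box at offset `0` (`p₁ ≤ π/2`) and `cos p₁ ≤ 0`
on the box at offset `3t` (`π/2 ≤ p₁ ≤ π`). [folklore] -/
theorem cos_box {t : ℕ} (ht : 1 ≤ t) (hL : L = 12 * t) {o : ℕ} (ho : o = 0 ∨ o = 3 * t)
    {k : TorusSite 2 L}
    (hk : k ∈ ((Finset.range (3 * t + 1) ×ˢ Finset.range (2 * t + 1)).image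
      (fun p : ℕ × ℕ => (![((o + p.1 : ℕ) : ZMod L), ((p.2 : ℕ) : ZMod L)] : TorusSite 2 L)))) :
    1 / 2 ≤ Real.cos (latticeMomentum L k 1) ∧
      (o = 0 → 0 ≤ Real.cos (latticeMomentum L k 0)) ∧
      (o = 3 * t → Real.cos (latticeMomentum L k 0) ≤ 0) := by
  have hot : o + 3 * t < L := by rcases ho with rfl | rfl <;> omega
  have h2t : 2 * t < L := by omega
  obtain ⟨i, j, hi, hj, hk0, hk1⟩ := mem_box_iff hot h2t hk
  have htpos : (0 : ℝ) < t := by exact_mod_cast ht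
  have hLr : (L : ℝ) = 12 * t := by rw [hL]; push_cast; ring
  have hi' : (i : ℝ) ≤ 3 * t := by exact_mod_cast hi
  have hj' : (j : ℝ) ≤ 2 * t := by exact_mod_cast hj
  have hp1 : latticeMomentum L k 0 = 2 * Real.pi * ((o : ℝ) + i) / (12 * t) := by
    rw [show latticeMomentum L k 0 = 2 * Real.pi * ((k 0).val : ℝ) / L from rfl, hk0, hLr]
    push_cast
    ring
  have hp2 : latticeMomentum L k 1 = 2 * Real.pi * (j : ℝ) / (12 * t) := by
    rw [show latticeMomentum L k 1 = 2 * Real.pi * ((k 1).val : ℝ) / L from rfl, hk1, hLr]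
  refine ⟨?_, ?_, ?_⟩
  · rw [hp2, ← Real.cos_pi_div_three]
    refine Real.cos_le_cos_of_nonneg_of_le_pi (by positivity) (by linarith [Real.pi_pos]) ?_
    rw [div_le_iff₀ (by positivity)]
    nlinarith [Real.pi_pos]
  · rintro rfl
    rw [hp1]
    refine Real.cos_nonneg_of_neg_pi_div_two_le_of_le ?_ ?_
    · have : 0 ≤ 2 * Real.pi * ((0 : ℕ) + (i : ℝ)) / (12 * t) := by positivity
      linarith [Real.pi_pos]
    · rw [div_le_iff₀ (by positivity)]
      push_cast
      nlinarith [Real.pi_pos]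
  · rintro rfl
    rw [hp1]
    refine Real.cos_nonpos_of_pi_div_two_le_of_le ?_ ?_
    · rw [le_div_iff₀ (by positivity)]
      push_cast
      nlinarith [Real.pi_pos]
    · rw [div_le_iff₀ (by positivity)]
      push_cast
      nlinarith [Real.pi_pos]

end Box

end Summit.HubbardSuperconductivity.HubbardSuperconductivity.Theorems.WindowInfraredBound.Negative
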